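import Literature.AlgebraicGeometry.Morphisms.CofanPieceMapFamily
import HarnessLib

/-!
# Piece maps re-typed at a SECTION of the index map, and index matching along composites

Topic: `Literature/AlgebraicGeometry/Morphisms`.  PROOF FILE (theorems only; no definition, no named fact, no instance); corollary
layer of ★ `CofanPieceMap` (p759656) and ★ `CofanPieceMapFamily` (p762463).  Setting: colimit cofans `(f″_k : X″_k ⟶ S″)`,
`(f′_j : X′_j ⟶ S′)`, `(f_i : X_i ⟶ S)` in `Over B` (the complex fibres of three levels `X_{N″} → X_N → X_K` of a tower of curves,
decomposed into irreducible pieces) and morphisms `T₁ : S″ ⟶ S′` (the Galois transition `q′`), `T₂ : S′ ⟶ S` (a translate `T_γ` or the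
level map `u`), `T = T₁ ≫ T₂` (`u″ = q′ ≫ T_γ`, `T_{γ⁻¹}^{N″ → K} = q′ ≫ u`).

THE BOOKKEEPING PROBLEM.  A piece-map system `(r, tq)` of `T₁` (★ `Over.exists_pieceMap_of_isColimit_cofan`) types the lift of the piece
`k` as `tq k : X″_k ⟶ X′_{r k}`; a consumer working ONE CHOSEN PIECE `ch j` over each target piece `j` (the single-piece form of the
transposed Hecke word, ★ `HeckeEndomorphismTransposedWordSinglePiece`) wants the lift typed at `j` itself, `X″_{ch j} ⟶ X′_j`, and wants
the indices of ANY piece-map system of the composite `T` at `ch j` to BE the indices of `T₂` at `j` — with no casts.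

* §1 `Over.pieceMap_index_surjective` — the index map `r` of a surjective `T₁` is surjective (every target piece is hit: points lift,
  pieces are disjoint; ★ `exists_eq_of_isColimit_cofan`, ★ `pairwise_disjoint_range_of_isColimit_cofan`).
* §2 `Over.exists_pieceMap_section` — from `r` surjective: a section `ch` (`r (ch j) = j`) AND the lift RE-TYPED at `j`,
  `tq′ j : X″_{ch j} ⟶ X′_j`, `tq′ j ≫ f′_j = f″_{ch j} ≫ T₁` (the index equation is `subst`ituted INSIDE the existential, once).
* §3 `Over.pieceMap_section_comp_fac`, `Over.pieceMap_index_eq_of_section`, `Over.pieceMap_eq_of_section` — the composite lift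
  `tq′ j ≫ t₂ j : X″_{ch j} ⟶ X_{φ₂ j}` lifts `T`, and ANY lift of `T` from the piece `ch j` has index `φ₂ j` and equals it
  (★ `Over.pieceMap_index_unique`, ★ `Over.pieceMap_unique`); `Over.pieceMap_index_eq_comp_section` — the same for a full system
  `(φ, t)` of `T`: `φ (ch j) = φ₂ j`; `Over.pieceMap_section_eq_comp_eqToHom` — its lift, transported along that index equality, is the
  composite lift.

Cell `hodgecm-mathlib` (D-0151), crux HLiu418 = stmt-HodgeConjecture-24832, d6 `stub_RosH` glue, frame `slot_letters`, hand (G4Σ): the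
identities «`b″ (ch c′) = φ γ c′`» (`T = u″ = q′ ≫ T_γ`) and «`φ″ (ch c′) = bN c′`» (`T = T_{γ⁻¹}^{N″→K} = q′ ≫ u`) that put the
single-piece transposed word into the index currency `I = ↥s × C_N`, `a = bN`, `b = φ γ` of the (hx) junction
★ `algEquiv_symm_endAlgebraBaseChange_heckeEnd_eq_smul_fan_sum`.  COUNT-NEUTRAL: HC_CM is proved only modulo the 7 printed citations until
rung 0 closes; nothing here is specific to it.

[cite: GortzWedhorn2020, Lemma 1.19 (1) (§(1.5)) with §(3.5) Proposition 3.10 and Example 3.11 (p. 73)]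

Mathlib searched: `Classical.choose`, `Function.Surjective`, `eqToHom`; no statement about morphisms between coproducts of schemes
(as for ★ p759656 / ★ p762463).
-/

set_option autoImplicit false

noncomputable section

open CategoryTheory CategoryTheory.Limits AlgebraicGeometry Set Function

namespace Literature.AlgebraicGeometry.Morphisms

universe v v' v'' u

variable {B : Scheme.{u}}
  {σ : Type v} {X : σ → Over B} {S : Over B} {f : ∀ i, X i ⟶ S}
  {σ' : Type v'} {X' : σ' → Over B} {S' : Over B} {f' : ∀ j, X' j ⟶ S'}
  {σ'' : Type v''} {X'' : σ'' → Over B} {S'' : Over B} {f'' : ∀ k, X'' k ⟶ S''}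

/-! ## §1 The index map of a surjective morphism is surjective -/

/-- **Every piece of the target is hit.**  For colimit cofans `(f″_k : X″_k ⟶ S″)`, `(f′_j : X′_j ⟶ S′)` in `Over B` with non-empty pieces
`X′_j`, a morphism `T₁ : S″ ⟶ S′` surjective on points, and a piece-map system `tq k : X″_k ⟶ X′_{r k}` (`tq k ≫ f′_{r k} = f″_k ≫ T₁`),
the index map `r` is surjective: a point of `X′_j` is `T₁` of a point of `S″`, which lies in some piece `X″_k`
(★ `exists_eq_of_isColimit_cofan`), whose image lies in `X′_{r k}`; distinct pieces of `S′` are disjoint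
(★ `pairwise_disjoint_range_of_isColimit_cofan`), so `r k = j`.
[cite: GortzWedhorn2020, §(3.5) Proposition 3.10 and Example 3.11 (p. 73)] -/
theorem Over.pieceMap_index_surjective [Small.{u} σ'] [Small.{u} σ''] (hc'' : IsColimit (Cofan.mk S'' f''))
    (hc' : IsColimit (Cofan.mk S' f')) [∀ j, Nonempty (X' j).left] {T₁ : S'' ⟶ S'}
    (hT₁ : Function.Surjective T₁.left.base) {r : σ'' → σ'} (tq : ∀ k, X'' k ⟶ X' (r k))
    (htq : ∀ k, tq k ≫ f' (r k) = f'' k ≫ T₁) : Function.Surjective r := by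
  intro j
  obtain ⟨x⟩ := (inferInstance : Nonempty (X' j).left)
  obtain ⟨y, hy⟩ := hT₁ ((f' j).left.base x)
  obtain ⟨hc''l⟩ := isColimit_cofan_left hc''
  obtain ⟨k, z, hz⟩ := exists_eq_of_isColimit_cofan hc''l y
  refine ⟨k, ?_⟩
  obtain ⟨hc'l⟩ := isColimit_cofan_left hc'
  by_contra hne
  have hdis := pairwise_disjoint_range_of_isColimit_cofan hc'l hne
  -- `f′_j x = T₁ y = T₁ (f″_k z) = f′_{r k} (tq k z)`
  have h := congrArg (fun g : X'' k ⟶ S' => g.left.base z) (htq k)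
  simp only [Over.comp_left, Scheme.Hom.comp_apply] at h
  exact Set.disjoint_left.mp hdis ⟨(tq k).left.base z, rfl⟩ ⟨x, by rw [h, hz, hy]⟩

/-! ## §2 The lift re-typed at a section -/

/-- **One chosen piece over each target piece, with its lift typed at the target piece.**  If the index map `r` of a piece-map system
`(r, tq)` of `T₁ : S″ ⟶ S′` is surjective, there are a section `ch` of `r` and lifts `tq′ j : X″_{ch j} ⟶ X′_j` with
`tq′ j ≫ f′_j = f″_{ch j} ≫ T₁` — the SAME morphisms `tq (ch j)`, their target re-typed along `r (ch j) = j` (substituted inside the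
existential, so that no transport appears in the statement). [cite: GortzWedhorn2020, Lemma 1.19 (1) (§(1.5)) with §(3.5) Example 3.11 (p. 73)] -/
theorem Over.exists_pieceMap_section {T₁ : S'' ⟶ S'} {r : σ'' → σ'} (hr : Function.Surjective r)
    (tq : ∀ k, X'' k ⟶ X' (r k)) (htq : ∀ k, tq k ≫ f' (r k) = f'' k ≫ T₁) :
    ∃ (ch : σ' → σ'') (tq' : ∀ j, X'' (ch j) ⟶ X' j), (∀ j, r (ch j) = j) ∧ ∀ j, tq' j ≫ f' j = f'' (ch j) ≫ T₁ := by
  have h : ∀ j, ∃ (k : σ'') (t : X'' k ⟶ X' j), r k = j ∧ t ≫ f' j = f'' k ≫ T₁ := fun j => by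
    obtain ⟨k, rfl⟩ := hr j
    exact ⟨k, tq k, rfl, htq k⟩
  choose ch tq' hch htq' using h
  exact ⟨ch, tq', hch, htq'⟩

/-! ## §3 Index matching along a composite, at the section -/

/-- **The composite lift at the section**: `(tq′ j ≫ t₂ j) ≫ f_{φ₂ j} = f″_{ch j} ≫ (T₁ ≫ T₂)` — a lift of `T₁ ≫ T₂` from the piece
`ch j`, already typed `X″_{ch j} ⟶ X_{φ₂ j}`. [cite: GortzWedhorn2020, Lemma 1.19 (1) (§(1.5)) with §(3.5) Example 3.11 (p. 73)] -/
theorem Over.pieceMap_section_comp_fac {T₁ : S'' ⟶ S'} {T₂ : S' ⟶ S} {ch : σ' → σ''}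
    (tq' : ∀ j, X'' (ch j) ⟶ X' j) (htq' : ∀ j, tq' j ≫ f' j = f'' (ch j) ≫ T₁)
    {φ₂ : σ' → σ} (t₂ : ∀ j, X' j ⟶ X (φ₂ j)) (h₂ : ∀ j, t₂ j ≫ f (φ₂ j) = f' j ≫ T₂) (j : σ') :
    (tq' j ≫ t₂ j) ≫ f (φ₂ j) = f'' (ch j) ≫ (T₁ ≫ T₂) := by
  rw [Category.assoc, h₂, ← Category.assoc, htq', Category.assoc]

/-- **Any lift of the composite from the chosen piece has the index of `T₂`**: if `t ≫ f_i = f″_{ch j} ≫ T` with `T = T₁ ≫ T₂` and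
`X″_{ch j}` non-empty, then `i = φ₂ j` (★ `Over.pieceMap_index_unique` against the composite lift).  The two uses in the d6 glue:
`T = u″ = q′ ≫ T_γ` («`b″ (ch c′) = φ γ c′`») and `T = T_{γ⁻¹}^{N″ → K} = q′ ≫ u` («`φ″ (ch c′) = bN c′`»).
[cite: GortzWedhorn2020, §(3.5) Proposition 3.10 and Example 3.11 (p. 73)] -/
theorem Over.pieceMap_index_eq_of_section [Small.{u} σ] (hc : IsColimit (Cofan.mk S f))
    {T₁ : S'' ⟶ S'} {T₂ : S' ⟶ S} {T : S'' ⟶ S} (hT : T = T₁ ≫ T₂) {ch : σ' → σ''}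
    (tq' : ∀ j, X'' (ch j) ⟶ X' j) (htq' : ∀ j, tq' j ≫ f' j = f'' (ch j) ≫ T₁)
    {φ₂ : σ' → σ} (t₂ : ∀ j, X' j ⟶ X (φ₂ j)) (h₂ : ∀ j, t₂ j ≫ f (φ₂ j) = f' j ≫ T₂)
    {j : σ'} [Nonempty (X'' (ch j)).left] {i : σ} (t : X'' (ch j) ⟶ X i) (h : t ≫ f i = f'' (ch j) ≫ T) : i = φ₂ j := by
  subst hT
  exact Over.pieceMap_index_unique hc t _ h (Over.pieceMap_section_comp_fac tq' htq' t₂ h₂ j)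

/-- **… and the lift IS the composite lift** (★ `Over.pieceMap_unique`). [cite: GortzWedhorn2020, §(3.5) Proposition 3.10 and Example 3.11 (p. 73)] -/
theorem Over.pieceMap_eq_of_section [Small.{u} σ] (hc : IsColimit (Cofan.mk S f))
    {T₁ : S'' ⟶ S'} {T₂ : S' ⟶ S} {T : S'' ⟶ S} (hT : T = T₁ ≫ T₂) {ch : σ' → σ''}
    (tq' : ∀ j, X'' (ch j) ⟶ X' j) (htq' : ∀ j, tq' j ≫ f' j = f'' (ch j) ≫ T₁)
    {φ₂ : σ' → σ} (t₂ : ∀ j, X' j ⟶ X (φ₂ j)) (h₂ : ∀ j, t₂ j ≫ f (φ₂ j) = f' j ≫ T₂)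
    (j : σ') (t : X'' (ch j) ⟶ X (φ₂ j)) (h : t ≫ f (φ₂ j) = f'' (ch j) ≫ T) : t = tq' j ≫ t₂ j := by
  subst hT
  exact Over.pieceMap_unique hc t _ h (Over.pieceMap_section_comp_fac tq' htq' t₂ h₂ j)

/-- **Index matching for a full piece-map system of the composite**: if `(φ, t)` is any piece-map system of `T = T₁ ≫ T₂`
(`t k ≫ f_{φ k} = f″_k ≫ T` for all `k`), then at the chosen pieces `φ (ch j) = φ₂ j`.
[cite: GortzWedhorn2020, §(3.5) Proposition 3.10 and Example 3.11 (p. 73)] -/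
theorem Over.pieceMap_index_eq_comp_section [Small.{u} σ] (hc : IsColimit (Cofan.mk S f))
    {T₁ : S'' ⟶ S'} {T₂ : S' ⟶ S} {T : S'' ⟶ S} (hT : T = T₁ ≫ T₂) {ch : σ' → σ''}
    (tq' : ∀ j, X'' (ch j) ⟶ X' j) (htq' : ∀ j, tq' j ≫ f' j = f'' (ch j) ≫ T₁)
    {φ₂ : σ' → σ} (t₂ : ∀ j, X' j ⟶ X (φ₂ j)) (h₂ : ∀ j, t₂ j ≫ f (φ₂ j) = f' j ≫ T₂)
    {φ : σ'' → σ} (t : ∀ k, X'' k ⟶ X (φ k)) (h : ∀ k, t k ≫ f (φ k) = f'' k ≫ T)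
    (j : σ') [Nonempty (X'' (ch j)).left] : φ (ch j) = φ₂ j :=
  Over.pieceMap_index_eq_of_section hc hT tq' htq' t₂ h₂ (t (ch j)) (h (ch j))

/-- Transport of a lift along an equality of piece indices keeps the lifting equation. [folklore] -/
private theorem Over.comp_eqToHom_comp_leg {A : Over B} {i i' : σ} (hi : i = i') (t : A ⟶ X i) :
    (t ≫ eqToHom (congrArg X hi)) ≫ f i' = t ≫ f i := by
  subst hi
  rw [eqToHom_refl, Category.comp_id]

/-- **The lift of a full system at the chosen piece, transported along the index equality, is the composite lift**:
`t (ch j) ≫ eqToHom _ = tq′ j ≫ t₂ j` (★ `Over.pieceMap_unique`). [cite: GortzWedhorn2020, §(3.5) Proposition 3.10 and Example 3.11 (p. 73)] -/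
theorem Over.pieceMap_section_eq_comp_eqToHom [Small.{u} σ] (hc : IsColimit (Cofan.mk S f))
    {T₁ : S'' ⟶ S'} {T₂ : S' ⟶ S} {T : S'' ⟶ S} (hT : T = T₁ ≫ T₂) {ch : σ' → σ''}
    (tq' : ∀ j, X'' (ch j) ⟶ X' j) (htq' : ∀ j, tq' j ≫ f' j = f'' (ch j) ≫ T₁)
    {φ₂ : σ' → σ} (t₂ : ∀ j, X' j ⟶ X (φ₂ j)) (h₂ : ∀ j, t₂ j ≫ f (φ₂ j) = f' j ≫ T₂)
    {φ : σ'' → σ} (t : ∀ k, X'' k ⟶ X (φ k)) (h : ∀ k, t k ≫ f (φ k) = f'' k ≫ T)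
    (j : σ') [Nonempty (X'' (ch j)).left] :
    t (ch j) ≫ eqToHom (congrArg X (Over.pieceMap_index_eq_comp_section hc hT tq' htq' t₂ h₂ t h j)) = tq' j ≫ t₂ j :=
  Over.pieceMap_eq_of_section hc hT tq' htq' t₂ h₂ j _
    ((Over.comp_eqToHom_comp_leg (f := f) (Over.pieceMap_index_eq_comp_section hc hT tq' htq' t₂ h₂ t h j)
      (t (ch j))).trans (h (ch j)))

end Literature.AlgebraicGeometry.Morphisms

end
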